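import Summits.NavierStokesRegularity.TurbBounds.Certs.N1prime.EvalData7
import Summits.NavierStokesRegularity.TurbBounds.CouplingSplit
import Summits.NavierStokesRegularity.TurbBounds.TailN1primeLadderForms
import Summits.NavierStokesRegularity.TurbBounds.TailN1primeExt
import Summits.NavierStokesRegularity.TurbBounds.QuadFormEval
import HarnessLib

/-!
# Row RB-N1′ tail lemma (dim 62) — structured quadratic form of the literal rule piece `TW`, part 13/14 (v2.1: list-level evaluation)
(cell `pub-turb` / `turb-bounds`; v2; GENERATED by pub-turb-cert gen 7 `emit_pieces_v21.py N1prime` from the staged `Certs/N1prime/EvalData*.lean`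
literals; the identity says 'this literal (projected) piece IS the Legendre–Galerkin object of rbsdp SPEC 3.3–3.6 on the kept coordinates'
(LEAN-MAP data item (a) for row RB-N1′). Proof: `QuadFormEval.dotProduct_mulVec_eq_rowsEval` turns the quadratic form into a structural
recursion over the row lists (unfolded by `simp only`, linear in the 293 listed entries), then `ring` over the ladder forms.)

HONEST FRAMING: rigorous bounds for the stated PDE and boundary conditions; no claim about physical turbulence beyond the bound.
-/

set_option linter.style.longLine false
set_option linter.style.setOption false
set_option maxRecDepth 100000

noncomputable section

namespace Summit.NavierStokesRegularity.TurbBounds.TailN1prime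

open Finset Matrix Literature.Computation.Certificates
open Summit.NavierStokesRegularity.TurbBounds.LadderTail (w phi lam)
open Summit.NavierStokesRegularity.TurbBounds.CouplingSplit (couplingMode)
open Summit.NavierStokesRegularity.TurbBounds.Certs.N1prime.Evaluator

set_option maxHeartbeats 20000000 in
/-- structured quadratic form of the literal piece `TW` (62×62 kept coordinates, 293 listed / 38 nonzero entries) -/
theorem quadForm_TW (x : Fin 62 → ℝ) :
    x ⬝ᵥ (TW.map (Rat.cast : ℚ → ℝ) *ᵥ x) = (w 25 * bL x 25 ^ 2 + w 26 * bL x 26 ^ 2 + w 27 * bL x 27 ^ 2 + w 28 * bL x 28 ^ 2 + w 29 * bL x 29 ^ 2 + w 30 * bL x 30 ^ 2) + phi 30 * aL x 30 ^ 2 + phi 31 * aL x 31 ^ 2 + lam 30 * (phi 31 * xc x 31 ^ 2 + phi 32 * xc x 32 ^ 2) := by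
  rw [show TW = matrixOfRows 62 62 TW_rows from rfl,
    QuadFormEval.dotProduct_mulVec_eq_rowsEval TW_rows x (ext x) (ext_val x) (ext_zero x)]
  simp only [TW_rows, TW_rows_r0, TW_rows_r1, TW_rows_r2, TW_rows_r3, TW_rows_r4, TW_rows_r5, TW_rows_r6, TW_rows_r7, TW_rows_r8, TW_rows_r9, TW_rows_r10, TW_rows_r11, TW_rows_r12, TW_rows_r13, TW_rows_r14, TW_rows_r15, TW_rows_r16, TW_rows_r17, TW_rows_r18, TW_rows_r19, TW_rows_r20, TW_rows_r21, TW_rows_r22, TW_rows_r23, TW_rows_r24, TW_rows_r25, TW_rows_r26, TW_rows_r27, TW_rows_r28, TW_rows_r29, TW_rows_r30, TW_rows_r31, TW_rows_r32, TW_rows_r33, TW_rows_r34, TW_rows_r35, TW_rows_r36, TW_rows_r37, TW_rows_r38, TW_rows_r39, TW_rows_r40, TW_rows_r41, TW_rows_r42, TW_rows_r43, TW_rows_r44, TW_rows_r45, TW_rows_r46, TW_rows_r47, TW_rows_r48, TW_rows_r49, TW_rows_r50, TW_rows_r51, TW_rows_r52, TW_rows_r53, TW_rows_r54, TW_rows_r55,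 TW_rows_r56, TW_rows_r57, TW_rows_r58, TW_rows_r59, TW_rows_r60, TW_rows_r61,
    QuadFormEval.rowsEval_cons, QuadFormEval.rowsEval_nil, QuadFormEval.rowEval_cons, QuadFormEval.rowEval_nil, ext, Rat.cast_zero, zero_mul, mul_zero, zero_add, add_zero,
    bL, aL, xc, w, phi, lam]
  push_cast
  ring

end Summit.NavierStokesRegularity.TurbBounds.TailN1prime

end
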